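import Mathlib
import Summits.ValiantsHypothesis.ValiantsHypothesis.Theorems.LiouvilleSarnakAlignedTypeICharactersMod2nBilinearSievePostnikovCyclic
import HarnessLib

/-!
# Route LiouvilleSarnak — support `AlignedTypeI` (stmt-ValiantsHypothesis-21040), line `characters_mod_2n`:
# transport of an abstract `2`-adic logarithm along the powers of `g = 1 + 2^τ` (input of Postnikov's formula)

Third brick for `HS`.  Postnikov's formula will be obtained from a "logarithm" `Λ : ℕ → ℤ` on `1 + 2^τℕ` that is a
homomorphism modulo `2^{n+τ}`:  `Λ(a + b + 2^τab) ≡ Λ(a) + Λ(b)` (the truncated `2`-adic `log(1 + 2^τ w)`, to be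
supplied), and depends on `w` only modulo `2^n`.  Here we record the purely formal consequences:

* `powShift_succ` — the exponents `w_d = ((1 + 2^τ)^d − 1)/2^τ` (`1 + 2^τ w_d = g^d`,
  `…PostnikovCyclic.one_add_two_pow_mul_powShift`) satisfy `w_{d+1} = w_d + 1 + 2^τ w_d`;
* `log_powShift_eq_smul` — hence `Λ(w_d) ≡ d · Λ(1) (mod 2^{n+τ})` for such a `Λ`;
* `modEq_of_one_add_two_pow_mul_eq` — `1 + 2^τ v ≡ 1 + 2^τ v' (mod 2^{n+τ}) ⟹ v ≡ v' (mod 2^n)`;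
* `log_eq_smul_of_pow_eq` — ★ if `1 + 2^τ v ≡ g^d (mod 2^{n+τ})` then `Λ(v) ≡ d · Λ(1) (mod 2^{n+τ})`.

With `…PostnikovCyclic.exists_pow_eq_one_add_two_pow_mul` (every `1 + 2^τ v` is some `g^d`) this reduces Postnikov's
formula `χ(1 + 2^τ v) = e(cΛ(v)/2^{n+τ})` to: the explicit truncated logarithm satisfies the two hypotheses, and
`v₂(Λ(1)) = τ` (then `χ(g) = e(k/2^n)`, `e(Λ(1)/2^{n+τ})` is a primitive `2^n`-th root of unity, `c = kℓ^{-1}`).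

HONEST FRAMING. Helper lemmas only (unconditional, hypotheses by arrow on the abstract `Λ`); the leaf `AlignedTypeI` is
NOT closed here; nothing bears on `VP ≠ VNP` (NOT proved).
-/

set_option linter.dupNamespace false

noncomputable section

namespace Summit.ValiantsHypothesis.ValiantsHypothesis.Theorems.LiouvilleSarnak.AlignedTypeI.CharactersModTwoN

open Finset

/-- The recursion of the exponents: `w_{d+1} = w_d + 1 + 2^τ w_d` for `w_d = ((1 + 2^τ)^d − 1)/2^τ`. [folklore] -/
theorem powShift_succ (τ d : ℕ) :
    ((1 + 2 ^ τ) ^ (d + 1) - 1) / 2 ^ τ =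
      ((1 + 2 ^ τ) ^ d - 1) / 2 ^ τ + 1 + 2 ^ τ * (((1 + 2 ^ τ) ^ d - 1) / 2 ^ τ) := by
  set w : ℕ := ((1 + 2 ^ τ) ^ d - 1) / 2 ^ τ with hw
  have hd : 1 + 2 ^ τ * w = (1 + 2 ^ τ) ^ d := one_add_two_pow_mul_powShift τ d
  have hpos : 0 < 2 ^ τ := by positivity
  have e : (1 + 2 ^ τ) ^ (d + 1) - 1 = 2 ^ τ * (w + 1 + 2 ^ τ * w) := by
    rw [pow_succ, ← hd]
    have : (1 + 2 ^ τ * w) * (1 + 2 ^ τ) = 1 + 2 ^ τ * (w + 1 + 2 ^ τ * w) := by ring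
    rw [this, Nat.add_sub_cancel_left]
  rw [e, Nat.mul_div_cancel_left _ hpos]

/-- **Transport along the powers of `g`**: if `Λ(a + b + 2^τab) ≡ Λ(a) + Λ(b) (mod q)` for all `a, b`, then
`Λ(w_d) ≡ d · Λ(1) (mod q)`, `w_d = ((1 + 2^τ)^d − 1)/2^τ`. [folklore] -/
theorem log_powShift_eq_smul {q τ : ℕ} (Λ : ℕ → ℤ)
    (hhom : ∀ a b : ℕ, ((Λ (a + b + 2 ^ τ * a * b) : ℤ) : ZMod q) = (Λ a : ZMod q) + (Λ b : ZMod q))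
    (d : ℕ) :
    ((Λ (((1 + 2 ^ τ) ^ d - 1) / 2 ^ τ) : ℤ) : ZMod q) = (d : ZMod q) * (Λ 1 : ZMod q) := by
  induction d with
  | zero =>
    have h0 := hhom 0 0
    simp only [add_zero, mul_zero] at h0
    have hΛ0 : ((Λ 0 : ℤ) : ZMod q) = 0 := by
      have : ((Λ 0 : ℤ) : ZMod q) + ((Λ 0 : ℤ) : ZMod q) - ((Λ 0 : ℤ) : ZMod q) = 0 := by
        rw [← h0, sub_self]
      simpa using this
    simp [hΛ0]
  | succ d ih =>
    rw [powShift_succ]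
    have h := hhom (((1 + 2 ^ τ) ^ d - 1) / 2 ^ τ) 1
    rw [mul_one] at h
    rw [h, ih]
    push_cast
    ring

/-- Cancelling `2^τ`: `1 + 2^τ v ≡ 1 + 2^τ v' (mod 2^{n+τ})` implies `v ≡ v' (mod 2^n)`. [folklore] -/
theorem modEq_of_one_add_two_pow_mul_eq {τ n v v' : ℕ}
    (h : ((1 + 2 ^ τ * v : ℕ) : ZMod (2 ^ (n + τ))) = ((1 + 2 ^ τ * v' : ℕ) : ZMod (2 ^ (n + τ)))) :
    v % 2 ^ n = v' % 2 ^ n := by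
  rw [ZMod.natCast_eq_natCast_iff] at h
  -- `h : 1 + 2^τ v ≡ 1 + 2^τ v' [MOD 2^(n+τ)]`
  have h1 : 2 ^ τ * v ≡ 2 ^ τ * v' [MOD 2 ^ τ * 2 ^ n] := by
    rw [← pow_add, add_comm τ n]
    exact Nat.ModEq.add_left_cancel' 1 h
  exact Nat.ModEq.mul_left_cancel' (by positivity) h1

/-- ★ **The logarithm of any `1 + 2^τ v` along the powers of `g`**: if `Λ` is a homomorphism mod `2^{n+τ}` as above and
depends on its argument only mod `2^n`, and `1 + 2^τ v ≡ (1 + 2^τ)^d (mod 2^{n+τ})`, then `Λ(v) ≡ d · Λ(1) (mod 2^{n+τ})`.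
[folklore] -/
theorem log_eq_smul_of_pow_eq {τ n : ℕ} (Λ : ℕ → ℤ)
    (hhom : ∀ a b : ℕ, ((Λ (a + b + 2 ^ τ * a * b) : ℤ) : ZMod (2 ^ (n + τ))) =
      (Λ a : ZMod (2 ^ (n + τ))) + (Λ b : ZMod (2 ^ (n + τ))))
    (hper : ∀ a b : ℕ, a % 2 ^ n = b % 2 ^ n → ((Λ a : ℤ) : ZMod (2 ^ (n + τ))) = (Λ b : ZMod (2 ^ (n + τ))))
    {v d : ℕ}
    (hv : ((1 + 2 ^ τ * v : ℕ) : ZMod (2 ^ (n + τ))) = (((1 + 2 ^ τ : ℕ) : ZMod (2 ^ (n + τ)))) ^ d) :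
    ((Λ v : ℤ) : ZMod (2 ^ (n + τ))) = (d : ZMod (2 ^ (n + τ))) * (Λ 1 : ZMod (2 ^ (n + τ))) := by
  have hw : ((1 + 2 ^ τ * v : ℕ) : ZMod (2 ^ (n + τ))) =
      ((1 + 2 ^ τ * (((1 + 2 ^ τ) ^ d - 1) / 2 ^ τ) : ℕ) : ZMod (2 ^ (n + τ))) := by
    rw [hv, one_add_two_pow_mul_powShift]
    push_cast
    ring
  rw [hper v _ (modEq_of_one_add_two_pow_mul_eq hw)]
  exact log_powShift_eq_smul Λ hhom d

/-- **Corollary** (with `…PostnikovCyclic.exists_pow_eq_one_add_two_pow_mul`): for EVERY `v` there is `d < 2^n` with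
`1 + 2^τ v ≡ g^d` and `Λ(v) ≡ d·Λ(1) (mod 2^{n+τ})`, `χ(1 + 2^τ v) = χ(g)^d` (`τ ≥ 2`). [folklore] -/
theorem exists_pow_and_log_eq {τ : ℕ} (hτ : 2 ≤ τ) (n : ℕ) (Λ : ℕ → ℤ)
    (hhom : ∀ a b : ℕ, ((Λ (a + b + 2 ^ τ * a * b) : ℤ) : ZMod (2 ^ (n + τ))) =
      (Λ a : ZMod (2 ^ (n + τ))) + (Λ b : ZMod (2 ^ (n + τ))))
    (hper : ∀ a b : ℕ, a % 2 ^ n = b % 2 ^ n → ((Λ a : ℤ) : ZMod (2 ^ (n + τ))) = (Λ b : ZMod (2 ^ (n + τ))))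
    (χ : DirichletCharacter ℂ (2 ^ (n + τ))) (v : ℕ) :
    ∃ d : ℕ, d < 2 ^ n ∧
      χ ((1 + 2 ^ τ * v : ℕ) : ZMod (2 ^ (n + τ))) = χ ((1 + 2 ^ τ : ℕ) : ZMod (2 ^ (n + τ))) ^ d ∧
      ((Λ v : ℤ) : ZMod (2 ^ (n + τ))) = (d : ZMod (2 ^ (n + τ))) * (Λ 1 : ZMod (2 ^ (n + τ))) := by
  obtain ⟨d, hd, h⟩ := exists_pow_eq_one_add_two_pow_mul hτ n v
  exact ⟨d, hd, by rw [h, map_pow], log_eq_smul_of_pow_eq Λ hhom hper h⟩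

end Summit.ValiantsHypothesis.ValiantsHypothesis.Theorems.LiouvilleSarnak.AlignedTypeI.CharactersModTwoN
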